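/-
Copyright (c) 2026. All rights reserved.
Released under Apache 2.0 license as described in the file LICENSE.
-/
import Literature.Probability.FitznerVanDerHofstad2017.NobleBoundsNMidS
import HarnessLib

/-!
# Fitzner–van der Hofstad (2017), §6.1 (6.4) / App. B: term-1 packages of a middle junction, variant `F‴`, cells `(a, 0, 0)`

[FvdH17] = R. Fitzner, R. van der Hofstad, *Generalized approach to the non-backtracking lace expansion*,
arXiv:1506.07977v2 (EJP 22 (2017), paper 43).  Page numbers refer to the arXiv version.

Continuation of `NobleBoundsNMidS` (cells `(a, 2, 0)`): the packages of a MIDDLE junction `k` (`1 ≤ k ≤ M`) of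
variant `F‴` (kind `midS`, (4.61), p. 41) for the cells `(a, c, a′) = (a, 0, 0)`, `a ∈ {1, 2}` — inner class
`0`: the last sausage of level `k + 1` is trivial, `t_k = z_k` ([FvdH17] §6.1 "Case b = 0", p. 59); exit class
`0` above (`w_{k+1} = u_{k+1}`) and `a ∈ {1, 2}` below.  The target is the `c = 0` summand
`A^{κ,a,0,*}(u,w,t,t) · A^{0,0}(t,t,w′,u′)` of the first term of the pointwise (5.4) (p. 48):

* letter `A^{κ,a,0,*}(u,w,t,t) = A^{κ,a,0}(u,w,t,t)` (App. B Table "A^{ι,a,b}", p. 75, rows `b = 0`, repulsive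
  triangle `𝓣_{1̲,1,0}`): the pivotal bond `{u ←1̲→ v}` and the exit line `{t ↔ w}` of level `k` with the entry
  line `{v ←1→ t}` of level `k + 1` (`v = b̄_k ≠ z_{k+1} = t` by `b̄_k ∉ C̃_k`, (4.64), p. 42);
* letter `A^{0,0}(t,t,w′,u′) = δ_{w′,u′} (1−δ_{w′,t}) ℙ(t ⇔ w′)` (App. B Table "A^{a,b}", p. 74, row `a = b = 0`):
  the lines `{t ↔ w′}` and `{z ↔ u′} = {t ↔ w′}` of level `k + 1`, a double connection on one level ((4.12), p. 35);
* the trivial sausage line `{t ↔ t}` and `{w′ ↔ u′}` of level `k + 1` form a letter of their own, bounded by `1`.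

§A the App. B rows as letter inequalities; §B `b̄_k ∉ C̃_k` at a middle level in closed form; §C the grouping;
§D the packages `nonempty_jPkg_midS_zero_zero`.

Conventions: `d`-generic; nothing is cited as a fact; additive.  Junction `k = i.castSucc = i₀.succ` as in
`NobleBoundsNMidS`.
-/

noncomputable section

namespace Literature.Probability.FitznerVanDerHofstad2017

open Literature.Barriers.CriticalPhenomena Literature.Probability.Percolation
open Literature.Probability.LatticeModels Literature.Combinatorics.SimpleGraph _root_.SimpleGraph
open _root_.MeasureTheory
open Literature.Probability.FitznerVanDerHofstad2017.NobleBlocks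
open Literature.Probability.FitznerVanDerHofstad2017.NobleBlocks.LenIdx
open scoped ENNReal

variable {d : ℕ}

/-! ### A. The App. B rows `A^{ι,a,0,*}` (`a = 1, 2`) and `A^{0,0}` as letter inequalities -/

section Rows

variable (p : unitInterval)

/-- Row `a ≥ 2, b = 0` of the `A^{ι,a,b,*}` table (`= A^{ι,a,0}`): `A^{ι,2,0,*}(0,v,x,y) = δ_{x,y} 𝓣_{1̲,1,0}(e,x,v)`.
[cite: FitznerVanDerHofstad2017, App. B Table "definition of A^{ι,a,b}(0,v,x,y)", row a ≥ 2, b = 0 (arXiv:1506.07977v2 p. 75)] -/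
theorem blockAiotaSt₀_two_zero (L : Letters d) (ι : Fin d × Bool) (v x y : Site d) :
    blockAiotaSt₀ L ι 2 0 v x y = kd x y * L.T (eq 1) (ge 1) (ge 0) (stepVec ι) x v := rfl

/-- Row `a = 1, b = 0` of the `A^{ι,a,b,*}` table: `A^{ι,1,0,*}(0,v,x,y) = δ_{x,y} (1−δ_{x,0}) 2dD(v) 𝓣_{1̲,1,0}(e,x,v)`.
[cite: FitznerVanDerHofstad2017, App. B Table "definition of A^{ι,a,b}(0,v,x,y)", row a = 1, b = 0 (arXiv:1506.07977v2 p. 75)] -/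
theorem blockAiotaSt₀_one_zero (L : Letters d) (ι : Fin d × Bool) (v x y : Site d) :
    blockAiotaSt₀ L ι 1 0 v x y = kd x y * kdc x 0 * twoDD v * L.T (eq 1) (ge 1) (ge 0) (stepVec ι) x v := rfl

/-- Row `a = b = 0` of the `A^{a,b}` table: `A^{0,0}(0,v,x,y) = δ_{x,y} δ_{v,0} (1−δ_{x,0}) ℙ(0 ⇔ x)`.
[cite: FitznerVanDerHofstad2017, App. B Table "definition of A^{a,b}(0,v,x,y)", row a = b = 0 (arXiv:1506.07977v2 p. 74)] -/
theorem blockA₀_zero_zero (L : Letters d) (v x y : Site d) :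
    blockA₀ L 0 0 v x y = kd x y * kd v 0 * (kdc x 0 * L.pdbc x) := rfl

/-- **Row `(2,0)` of `A^{ι,a,b,*}` as a three-line letter on two levels**: the lines `{u ←1̲→ v}`, `{v ←1→ t}`,
`{t ↔ w}` are bounded by `A^{ι,2,0,*}(u,w,t,t) = 𝓣_{1̲,1,0}(v−u, t−u, w−u)`.
[cite: FitznerVanDerHofstad2017, §6.1 "Case a ≥ 2", "Case b = 0" (arXiv:1506.07977v2 p. 59); App. B (p. 75); §4.2 (4.17) (p. 36)] -/
theorem piPerc_midS_two_zero_le_blockAiotaSt {ι : Fin d × Bool} {u v w t : Site d} (hv : v = u + stepVec ι)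
    (c : Fin 3 → Fin 2) :
    piPerc d p 2 (genDisjOcc ![event (eq 1) u v, event (ge 1) v t, event (ge 0) t w] c) ≤
      blockAiotaSt (Letters.perc d p) ι 2 0 u w t t := by
  have he : v - u = stepVec ι := by rw [hv, add_sub_cancel_left]
  rw [blockAiotaSt, ofBase, blockAiotaSt₀_two_zero, kd_self, one_mul, ← he]
  exact piPerc_genDisjOcc_le_T p (eq 1) (ge 1) (ge 0) u v t w c

/-- **Row `(1,0)` of `A^{ι,a,b,*}` as a three-line letter on two levels**: for `w` a lattice neighbour of `u` and
`t ≠ u`, the same three lines are bounded by `A^{ι,1,0,*}(u,w,t,t)`.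
[cite: FitznerVanDerHofstad2017, §6.1 "Case a = 1", "Case b = 0" (arXiv:1506.07977v2 p. 59); App. B (p. 75); §4.2 (4.17) (p. 36)] -/
theorem piPerc_midS_one_zero_le_blockAiotaSt {ι κ' : Fin d × Bool} {u v w t : Site d} (hv : v = u + stepVec ι)
    (hw : w = u + stepVec κ') (htu : t ≠ u) (c : Fin 3 → Fin 2) :
    piPerc d p 2 (genDisjOcc ![event (eq 1) u v, event (ge 1) v t, event (ge 0) t w] c) ≤
      blockAiotaSt (Letters.perc d p) ι 1 0 u w t t := by
  have he : v - u = stepVec ι := by rw [hv, add_sub_cancel_left]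
  have hk : w - u = stepVec κ' := by rw [hw, add_sub_cancel_left]
  rw [blockAiotaSt, ofBase, blockAiotaSt₀_one_zero, kd_self, kdc_of_ne (sub_ne_zero.2 htu), hk, twoDD_stepVec,
    ← hk, ← he]
  simp only [one_mul]
  exact piPerc_genDisjOcc_le_T p (eq 1) (ge 1) (ge 0) u v t w c

/-- **Row `(0,0)` of `A^{a,b}` as a two-line letter**: two bond-disjoint `{t ↔ w′}` witnesses on ONE level
(`t ≠ w′`) are bounded by `A^{0,0}(t,t,w′,w′) = ℙ(t ⇔ w′)`.
[cite: FitznerVanDerHofstad2017, App. B Table "definition of A^{a,b}(0,v,x,y)", row a = b = 0 (arXiv:1506.07977v2 p. 74); §4.2 (4.12) (p. 35)] -/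
theorem piPerc_midS_zero_zero_le_blockA {t w' : Site d} (htw : t ≠ w') (c : Fin 2 → Fin 2) (hc : c 0 = c 1) :
    piPerc d p 2 (genDisjOcc ![event (ge 0) t w', event (ge 0) t w'] c) ≤ blockA (Letters.perc d p) 0 0 t t w' w' := by
  have hx : w' - t ≠ 0 := sub_ne_zero.2 htw.symm
  rw [blockA, ofBase, blockA₀_zero_zero, kd_self, sub_self, kd_self, kdc_of_ne hx, Letters.pdbc, if_neg hx]
  simp only [one_mul]
  exact (piPerc_two_genDisjOcc_two_le_D p (ge 0) (ge 0) t w' c hc).trans (le_of_eq (perc_D_ge_zero_zero p _))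

end Rows

/-! ### B. `b̄_k ∉ C̃_k` at an open middle level, in closed form -/

section MidFacts

variable {M : ℕ} {x : Site d} {b : Fin (M + 2) → Site d × Site d} {w t z : Fin (M + 2) → Site d}
  {a : Fin (M + 2) → Fin 3 ⊕ Unit} {c : Fin 3 ⊕ Unit} {τ : Fin (M + 1) → Bool × Fin 3}
  {ω : Fin (M + 3) → BondConfig (Site d)} {K₀ : Fin (M + 3) → Fin 6 → Set (Sym2 (Site d))}

namespace JFacts

/-- `b̄_k ∉ C̃_k` read on the named vertices of an open middle level `k = i₀ + 1`:
`b̄_k ∉ {v_k, t_{k-1}, z_{k-1}, w_k, z_k}` (both variants). [cite: FitznerVanDerHofstad2017, (4.64) "{b̄_i ∉ C̃_i}" (arXiv:1506.07977v2 p. 42)] -/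
theorem notC_mid (h : JFacts M x b w t z a c τ ω K₀) (i₀ : Fin (M + 1)) {a₀ : Fin 3} (ha₀ : a i₀.succ = Sum.inl a₀) :
    (b i₀.succ).2 ∉ ({(b i₀.castSucc).2, t i₀.castSucc, z i₀.castSucc, w i₀.succ, z i₀.succ} : Set (Site d)) := by
  have hn := (h.level i₀.castSucc.succ).2.2
  rw [pieceViews_mid, ha₀] at hn
  obtain hb | hb := Bool.eq_false_or_eq_true ((τ i₀).1) <;> rw [hb] at hn <;> exact hn

/-- At the junction `k = i₀ + 1 = i.castSucc` over an open level `k`: the entry vertex `v_{k+1} = b̄_k` of level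
`k + 1` is not the cut point `z_k` of its sausage. [cite: FitznerVanDerHofstad2017, (4.64) (arXiv:1506.07977v2 p. 42)] -/
theorem v_ne_z_of_open (h : JFacts M x b w t z a c τ ω K₀) (i i₀ : Fin (M + 1)) (hk : i₀.succ = i.castSucc)
    {a₀ : Fin 3} (ha : a i.castSucc = Sum.inl a₀) : (b i.castSucc).2 ≠ z i.castSucc := by
  have hn := h.notC_mid i₀ (show a i₀.succ = Sum.inl a₀ by rw [hk]; exact ha)
  rw [hk] at hn
  exact fun he => hn (by simp [he])

end JFacts

end MidFacts

/-! ### C. The grouping of term 1, inner class `0` -/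

/-- The GROUPING of term 1 at a middle junction of variant `F‴` with a trivial sausage: letter `xb` =
{bond, lower lines, `up 0`} (`A^{κ,a,0,*}`), letter `up 2` = {`up 2`, `up 3`} (`A^{0,a′}`), letter `up 4` =
{`up 1` (trivial), `up 4`}. [cite: FitznerVanDerHofstad2017, §5.1 (5.4) first term (arXiv:1506.07977v2 p. 48); App. B (pp. 74–75)] -/
def glMidS0 : JIdx → JIdx
  | .xb => .xb
  | .xtz => .xtz
  | .lo _ => .xb
  | .up j => ![JIdx.xb, .up 4, .up 2, .up 2, .up 4, .up 5] j

section Grouping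

variable (M : ℕ) (x : Site d) (b : Fin (M + 2) → Site d × Site d) (w t z : Fin (M + 2) → Site d)
  (a : Fin (M + 2) → Fin 3 ⊕ Unit) (τ : Fin (M + 1) → Bool × Fin 3)

/-- **The grouping of term 1 (inner class `0`) obeys the (4.65) rule**: its only cross-level letter joins lower
lines with the entry slot `0` of level `k + 1`. [cite: FitznerVanDerHofstad2017, §4.4 (4.65) and the sentence after it (arXiv:1506.07977v2 p. 43)] -/
theorem glMidS0_entry (i : Fin (M + 1)) (hσ : (τ i).1 = false) {a' : Fin 3} (ha' : a i.succ = Sum.inl a')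
    (j j' : Fin 6) (hg : glMidS0 (.lo j) = glMidS0 (.up j')) :
    IsEntry (pieceViews M x b w t z a τ i.castSucc.succ).kd j' := by
  rw [pieceViews_mid_kd, ha', hσ]
  show (j' : ℕ) < 2
  fin_cases j' <;> simp [glMidS0] at hg ⊢

end Grouping

/-! ### D. The packages of the cells `(a, 0, 0)`, `a ∈ {1, 2}`, variant `F‴` -/

section Packages

variable (p : unitInterval) (M : ℕ) (x : Site d) (b : Fin (M + 2) → Site d × Site d) (w t z : Fin (M + 2) → Site d)
  (a : Fin (M + 2) → Fin 3 ⊕ Unit) (c : Fin 3 ⊕ Unit) (τ : Fin (M + 1) → Bool × Fin 3)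

/-- **Cells `(a, 0, 0)`, `a ∈ {1,2}`, variant `F‴`, of a middle junction `k = i₀ + 1 ≤ M`** (`1 ≤ k`): a package
with target the `c = 0` summand `A^{κ,a,0,*}(u_k,w_k,t_k,z_k) · A^{0,0}(t_k,z_k,w_{k+1},u_{k+1})` of the first
term of (5.4).  Inner class `0` identifies `z_k = t_k` (else the piece is empty), so the exit line of level `k`
reads `{t ↔ w}` and the entry line `{v ←1→ t}` (`v = b̄_k ≠ z_k`, (4.64)); exit class `0` above identifies
`w_{k+1} = u_{k+1}`, and the two lines `t → w_{k+1}`, `z → u_{k+1}` of level `k + 1` become a double connection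
`t ⇔ w_{k+1}` (`t ≠ u_{k+1}`, canonical clause of `F‴`).  (`a = 0` with `b = 0` is the row `𝓣_{1,1̲,1}` of a
different shape and is not treated here.)
[cite: FitznerVanDerHofstad2017, §6.1 (6.4), "Case a = 1 / a ≥ 2", "Case b = 0" (arXiv:1506.07977v2 pp. 58–59); §5.1 (5.4) (p. 48); App. B (pp. 74–75); (4.64) (p. 42)] -/
theorem nonempty_jPkg_midS_zero_zero (i i₀ : Fin (M + 1)) (hk : i₀.succ = i.castSucc) (κ : Fin d × Bool)
    (hb : (b i.castSucc).2 = (b i.castSucc).1 + stepVec κ) (hσ : (τ i).1 = false) (hc0 : (τ i).2 = 0)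
    (a₀ : Fin 3) (ha : a i.castSucc = Sum.inl a₀) (ha0 : a₀ ≠ 0) (ha' : a i.succ = Sum.inl 0) :
    Nonempty (JPkg p (jctx M x b w t z a τ i.castSucc) (JFacts M x b w t z a c τ)
      (blockAiotaSt (Letters.perc d p) κ a₀ 0 (b i.castSucc).1 (w i.castSucc) (t i.castSucc) (z i.castSucc) *
        blockA (Letters.perc d p) 0 0 (t i.castSucc) (z i.castSucc) (w i.succ) (b i.succ).1)) := by
  -- degenerate parameters: the piece is empty
  by_cases hP : z i.castSucc = t i.castSucc ∧ w i.succ = (b i.succ).1 ∧ t i.castSucc ≠ (b i.succ).1 ∧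
      (b i.castSucc).1 ≠ t i.castSucc ∧ (b i.castSucc).2 ≠ z i.castSucc ∧
      (a₀ = 1 → (zdGraph d).Adj (b i.castSucc).1 (w i.castSucc))
  swap
  · refine ⟨JPkg.vacuous p _ _ (fun ω K₀ hF => hP ?_) _⟩
    have hv := hF.vac_midS i hσ ha'
    refine ⟨(hF.t_eq_z_of_innerClass_zero i hc0).symm, hF.w_eq_of_exitClass_zero i.succ ha',
      (hF.canon_midS i hσ ha').2, fun h => hv (by simp [h]), hF.v_ne_z_of_open i i₀ hk ha,
      fun h1 => (hF.exitClass_one i.castSucc (ha.trans (by rw [h1]))).2.2⟩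
  obtain ⟨hzt, hwy, hty, hut, hvz, hw1⟩ := hP
  have huv : (b i.castSucc).1 ≠ (b i.castSucc).2 := by
    rw [hb]; exact (zdGraph_adj_iff_stepVec _ _ |>.2 ⟨κ, rfl⟩).ne
  have hvt : (b i.castSucc).2 ≠ t i.castSucc := by rw [← hzt]; exact hvz
  rw [hwy, hzt]
  refine nonempty_jPkg_of_joint p i.castSucc glMidS0 true
    (midEv (event (eq 1) (b i.castSucc).1 (b i.castSucc).2) (event (ge 1) (b i.castSucc).2 (t i.castSucc))
      Set.univ (event (ge 0) (t i.castSucc) (b i.succ).1) (event (ge 0) (t i.castSucc) (b i.succ).1) Set.univ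
      (event (ge 0) (t i.castSucc) (w i.castSucc)))
    (isFinitary_midEv _ _ _ _ _ _ _ (isFinitary_event _ _ _) (isFinitary_event _ _ _) isFinitary_univ
      (isFinitary_event _ _ _) (isFinitary_event _ _ _) isFinitary_univ (isFinitary_event _ _ _))
    (fun _ => by rw [midEv_xb]; exact singleton_mem_event_eq_one huv)
    (fun j j' _ _ hg => glMidS0_entry M x b w t z a τ i hσ ha' j j' hg)
    (fun ω K₀ hF => ⟨fun j hj => ?_, fun j hj => ?_⟩) ?_
  · -- the exit witness of level `k` (`w → z = t`) lies in the exit-line event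
    obtain rfl := (jMidOpen_act_lo_iff M x b w t z a τ i i₀ hk ha true false j).1 hj
    rw [midEv_lo_five]
    have h5 := hF.conn_exit i i₀ hk ha
    rw [hzt] at h5
    rw [event_comm, event_ge]
    exact mem_openConnGe_zero_of_mem h5
  · -- the witnesses of level `k + 1` lie in the upgraded events
    have hj5 : j ≠ 5 := (jMidS_act_up_iff M x b w t z a τ i hσ ha' true false j).1 hj
    obtain ⟨h0, -, h2, h3, -⟩ := hF.conn_midS i hσ ha'
    rw [hwy] at h2
    rw [hzt] at h3
    refine mem_midEv_up _ _ _ _ _ _ _ ?_ (Set.mem_univ _) ?_ ?_ (Set.mem_univ _) j hj5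
    · rw [event_ge]; exact mem_openConnGe_one_of_ne h0 hvt
    · rw [event_ge]; exact mem_openConnGe_zero_of_mem h2
    · rw [event_ge]; exact mem_openConnGe_zero_of_mem h3
  · -- the two letters
    refine (prod_junF_le₂ p M x b w t z a τ i.castSucc glMidS0 true false _
      (show JIdx.xb ≠ JIdx.up 2 by decide)).trans (mul_le_mul' ?_ ?_)
    · -- `A^{κ,a,0,*}`: bond, `v → t`, exit of level `k`, on levels `k, k+1, k`
      refine (junF_le_of_lines p M x b w t z a τ i.castSucc glMidS0 true false _ JIdx.xb
        ![JIdx.xb, .up 0, .lo 5] (by decide) (fun m => ?_) ![0, 1, 0] (fun m => by fin_cases m <;> rfl)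
        ![event (eq 1) (b i.castSucc).1 (b i.castSucc).2, event (ge 1) (b i.castSucc).2 (t i.castSucc),
          event (ge 0) (t i.castSucc) (w i.castSucc)]
        (by funext m; fin_cases m <;> rfl)).trans ?_
      · fin_cases m
        · exact ⟨rfl, rfl⟩
        · exact ⟨(jMidS_act_up_iff M x b w t z a τ i hσ ha' true false 0).2 (by decide), rfl⟩
        · exact ⟨(jMidOpen_act_lo_iff M x b w t z a τ i i₀ hk ha true false 5).2 rfl, rfl⟩
      · obtain h1 | h2 : a₀ = 1 ∨ a₀ = 2 := by
          fin_cases a₀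
          · exact absurd rfl ha0
          · exact Or.inl rfl
          · exact Or.inr rfl
        · subst h1
          obtain ⟨κ', hκ'⟩ := (zdGraph_adj_iff_stepVec _ _).1 (hw1 rfl)
          exact piPerc_midS_one_zero_le_blockAiotaSt p hb hκ' hut.symm _
        · subst h2
          exact piPerc_midS_two_zero_le_blockAiotaSt p hb _
    · -- `A^{0,0}`: the double connection `t ⇔ w′` on level `k + 1`
      refine (junF_le_of_lines p M x b w t z a τ i.castSucc glMidS0 true false _ (JIdx.up 2)
        ![JIdx.up 2, .up 3] (by decide) (fun m => ?_) ![1, 1] (fun m => by fin_cases m <;> rfl)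
        ![event (ge 0) (t i.castSucc) (b i.succ).1, event (ge 0) (t i.castSucc) (b i.succ).1]
        (by funext m; fin_cases m <;> rfl)).trans ?_
      · fin_cases m
        · exact ⟨(jMidS_act_up_iff M x b w t z a τ i hσ ha' true false 2).2 (by decide), rfl⟩
        · exact ⟨(jMidS_act_up_iff M x b w t z a τ i hσ ha' true false 3).2 (by decide), rfl⟩
      · exact piPerc_midS_zero_zero_le_blockA p hty _ rfl

end Packages

end Literature.Probability.FitznerVanDerHofstad2017

end
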